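import Literature.AlgebraicGeometry.Motives.GaloisThickeningPointsGalois
import Literature.AlgebraicGeometry.Motives.GaloisThickeningProductAction
import Literature.AlgebraicGeometry.Motives.IntegralModelReductionMapFrobenius
import HarnessLib

/-!
# The ambient Galois group moves the sheet of the Galois thickening; Frobenius on the reduction of a proper model of
# `R_L X`, modulo the deck transformations, is `σ`-conjugation downstairs

Topic `Literature/AlgebraicGeometry/Motives`, namespace `Literature.AlgebraicGeometry.Motives`.  THEOREMS only (no def, no instance,
no notation, no named fact, no `sorry`).  Sequel of ★ `Motives/GaloisThickening` (`R_L X = X ×_K Spec L` over `K`, the deck action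
`thickeningGalAction`, the sections `ℓ_e = thickeningLift e`, `(R_L X)(Ω) ≃ X(Ω) × Hom_K(L, Ω)`), ★ `Motives/GaloisThickeningPointsGalois`
(A-p14 (g31), organ GAL-6: `Aut(Ω∕K)` MOVES THE SHEET, `σ • ℓ_e P = ℓ_{σ ∘ e} (σ • P)`, and for `L ∕ K` normal a deck transformation restores
it, `smul_thickeningLift_eq_map_aut_symm`, `exists_algEquiv_comp_eq_comp`), ★ `Motives/GaloisThickeningProductAction` (`τ = thickeningProdAction X ρ`
of `Aut(L∕K) × G`) and ★ `Motives/IntegralModelReductionMapFrobenius` (an arithmetic Frobenius `σ ∈ Γ_{K_v}` reduces to the `q_v`-Frobenius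
`F̃` on EVERY proper model: `red_𝒳 (σ • x) = F̃ (red_𝒳 x)`).  THIS FILE is the REDUCTION layer (§2 of the cut A-p14 (g31) ∕ B-p18 (g34)
2026-09-01).  Cell `hodgecm-mathlib`, P6 «MOD programme»,
organ «FROB-SHEET-GEO» for the sub-line `Cruxes/HLiu418/Lines/F0_P6a_ModuliDatum.lean` (desk F0P6a-plan (g0); ED.-2 census
`ED2-CENSUS-P6a.v1` §5 «FROB-SHEET»; F0P6c-plan (g0) CENSUS-DICT v3 (β) «sheet-corrected Frobenius»; F0P6-ref1 o-5, the SHEET obstruction).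
HC_CM is proved only modulo the printed citations until rung 0 closes; nothing here is about HC (generic, moduli-free, CM-free).

THE MATHEMATICS.  Let `K ⊆ L` be fields, `Ω` a field over `K`, `X` a `K`-scheme.  An `Ω`-point of `R_L X = X ×_K Spec L` over `K` is a pair
`(P, e)` of an `Ω`-point `P` of `X` and a `K`-embedding `e : L → Ω` (its SHEET); `ℓ_e P` is the point `(P, e)`.  The group `Aut(Ω∕K)`
acts on `Ω`-points by `σ • Q = Spec σ ≫ Q` and MOVES THE SHEET: `σ • ℓ_e P = ℓ_{σ ∘ e} (σ • P)` (★ `smul_thickeningLift`).  When `L ∕ K`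
is normal, `σ ∘ e = e ∘ γ` for a (unique) deck transformation `γ = γ_{σ,e} ∈ Aut(L∕K)` (★ `exists_algEquiv_comp_eq_comp`), and since the
deck action permutes the sheets by `γ · ℓ_e = ℓ_{e ∘ γ⁻¹}` (★ `map_aut_thickeningLift`) one gets `σ • ℓ_e P = γ_{σ,e}⁻¹ · ℓ_e (σ • P)` with
`γ_{σ,e}` UNIFORM in `X` and `P` (★ `smul_thickeningLift_eq_map_aut_symm`).
Now let `K` be a number field, `v` a finite place, `Ω = \overline{K_v}`, `𝓨` ANY proper `𝒪_{K,(v)}`-model of `R_L X` and `𝔲 : 𝓨 → 𝓨` a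
model endomorphism whose generic fibre is the deck transformation `γ_{σ,e}⁻¹` (the square of ★ `IntegralModel.geomReductionMap_map`, which is
the letter UP's binder `_hθ`).  For an arithmetic Frobenius `σ ∈ Γ_{K_v}` (★ `IsAbsArithFrob`) and every `P ∈ X(Ω)`:
  `F̃ (red_𝓨 (ℓ_e P)) = red_𝓨 (σ • ℓ_e P) = red_𝓨 (γ_{σ,e}⁻¹ · ℓ_e (σ • P)) = 𝔲_s · red_𝓨 (ℓ_e (σ • P))`
(§2, `map_frobeniusOver_geomReductionMap_thickeningLift`), hence in every `𝔲_s`-INVARIANT, Frobenius-compatible reading `(P, mk, Fr)` of the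
`κ̄(v)`-points of the special fibre (`mk ∘ F̃ = Fr ∘ mk`, `mk ∘ 𝔲_s = mk` — the binders `_hFr`, `_hinv` of P6a's
`PointwiseFrobeniusDatumUpstairsAt`): **`Fr (mk (red_𝓨 (ℓ_e P))) = mk (red_𝓨 (ℓ_e (σ • P)))`** — modulo the deck transformations, the
upstairs Frobenius of the sheet-`e` lift of `P` IS the sheet-`e` lift of `σ • P` (`frobenius_reading_geomReductionMap_thickeningLift`, and the
form over an action `θ` of `Aut(L∕K) × G` on `𝓨` with generic fibre `thickeningProdAction X ρ`, literally the binders of the letter UP: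
`frobenius_reading_thickeningLift_of_actionOver`, iterate `iterate_frobenius_reading_thickeningLift_of_actionOver`, and the `∃ σ` package
`exists_isAbsArithFrob_forall_frobenius_reading_thickeningLift`).  This is the support letter `Fr` (★ `FrobeniusLiftOnReduction`, road 2
downstairs) ONE GALOIS LAYER UP with the sheet correction: the consumer (HEART of P6a ED. 3) reads the Frobenius clauses (c3a)(c3b)(c3c) off
`σ`-conjugation of generic points exactly as downstairs, with no Frobenius element to be named point by point.

Mathlib searched (pin): `AlgEquiv.restrictScalars`, `Over.OverMorphism.ext`, `Function.iterate_succ_apply`, `mul_smul`, `pow_succ` (used);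
Mathlib has no Weil restriction ∕ points-of-base-change API under a dedicated name.

## Main statements
* `isoMk_thickeningProdAction_aut_inl_hom` — plumbing: `τ(γ, 1)` in UP's `Over.isoMk` shape is the deck transformation `γ`.
* `IntegralModel.map_frobeniusOver_geomReductionMap_thickeningLift` — `F̃ (red (ℓ_e P)) = 𝔲_s · red (ℓ_e (σ • P))`.
* `IntegralModel.frobenius_reading_geomReductionMap_thickeningLift`, **`IntegralModel.frobenius_reading_thickeningLift_of_actionOver`**,
  `IntegralModel.iterate_frobenius_reading_thickeningLift_of_actionOver`, `IntegralModel.exists_isAbsArithFrob_forall_frobenius_reading_thickeningLift`.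
* (ED. 2, §3) `isoMk_thickeningGalAction_aut_hom`, `IntegralModel.map_specialFibre_aut_map_specialFibre_aut`,
  **`IntegralModel.exists_frobeniusShadow_reading_thickeningLift`**, **`IntegralModel.exists_frobeniusSheet_reading_thickeningLift`** (the letter
  MH's `FrobeniusSheet` conjunct with its reading `Fr₀ ∘ red_𝓨 ∘ ℓ_e = red_𝓨 ∘ ℓ_e ∘ (σ • ·)`), `IntegralModel.reading_of_frobeniusSheet`,
  `IntegralModel.exists_isAbsArithFrob_forall_frobeniusSheet_reading`.

## References
* [SerreTate1968] J.-P. Serre, J. Tate, *Good reduction of abelian varieties*, Ann. of Math. 88 (1968), §1 Lemma 2 (reduction commutes with the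
  decomposition group).
* [GortzWedhorn2020] U. Görtz, T. Wedhorn, *Algebraic Geometry I* (2nd ed. 2020), §(4.8)–(4.9), (14.20) (points of a base change; Galois twists).
* [Shimura1998] G. Shimura, *Abelian Varieties with Complex Multiplication and Modular Functions* (1998), §16.3 (1) («`(t^σ)~ = t̃^q`»).
-/

set_option autoImplicit false

noncomputable section

open CategoryTheory _root_.AlgebraicGeometry Limits IsDedekindDomain IsDedekindDomain.HeightOneSpectrum Field
open scoped NumberField
open Literature.NumberTheory.EllipticCurves (genericFibre)
open Literature.NumberTheory.GaloisRepresentations (IsAbsArithFrob exists_isAbsArithFrob_holds)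
open Literature.NumberTheory.DiophantineGeometry
open Literature.AlgebraicGeometry.RelativeSpec (ActionOver)

universe u

namespace Literature.AlgebraicGeometry.Motives

/-! ## §1 Plumbing: the `Aut(L∕K)`-component of the product action in the shape of the letter UP -/

section Plumbing

variable {K L : Type u} [Field K] [Field L] [Algebra K L]

/-- The `Aut(L∕K)`-component of the product action `τ = thickeningProdAction X ρ` at `(γ, 1)`, as a morphism over `Spec K` in the shape
`(Over.isoMk (τ.aut a) (τ.aut_comp a)).hom` of the letter UP, is the deck transformation `γ`. [cite: GortzWedhorn2020, (14.20)] -/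
theorem isoMk_thickeningProdAction_aut_inl_hom (X : SchemeOver K) {G : Type*} [Group G] (ρ : G →* Aut X) (γ : L ≃ₐ[K] L) :
    (Over.isoMk ((thickeningProdAction (L := L) X ρ).aut (γ, 1)) ((thickeningProdAction X ρ).aut_comp (γ, 1))).hom =
      Over.homMk ((thickeningGalAction X).aut γ).hom ((thickeningGalAction X).aut_comp γ) := by
  apply Over.OverMorphism.ext
  change ((thickeningProdAction (L := L) X ρ).aut (γ, 1)).hom = ((thickeningGalAction X).aut γ).hom
  rw [← thickeningProdAction_aut_comp_inl X ρ]
  rfl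

end Plumbing

/-! ## §2 Frobenius on the reduction of a proper model of `R_L X`, modulo the deck transformations -/

namespace IntegralModel

variable {K : Type} [Field K] [NumberField K] {v : HeightOneSpectrum (𝓞 K)} {L : Type} [Field L] [Algebra K L]

/-- **`F̃ (red_𝓨 (ℓ_e P)) = 𝔲_s · red_𝓨 (ℓ_e (σ • P))`.**  `𝓨` ANY proper `𝒪_{K,(v)}`-model of `R_L X`, `σ ∈ Γ_{K_v}` an arithmetic
Frobenius, `e : L → \overline{K_v}` a sheet with `σ ∘ e = e ∘ γ`, and `𝔲 : 𝓨 → 𝓨` a model endomorphism with generic fibre the deck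
transformation `γ⁻¹` (the square of ★ `geomReductionMap_map`).  Chain: `F̃ ∘ red = red ∘ σ` (★ `geomReductionMap_smul_of_isAbsArithFrob`), `σ`
moves the sheet and `γ⁻¹` restores it (★ `smul_thickeningLift_eq_map_aut_symm`), `red ∘ γ⁻¹ = 𝔲_s ∘ red` (★ `geomReductionMap_map`).
[cite: SerreTate1968, §1 Lemma 2] [cite: Shimura1998, §16.3 (1)] [cite: GortzWedhorn2020, (14.20)] -/
theorem map_frobeniusOver_geomReductionMap_thickeningLift (X : SchemeOver K)
    (𝓨 : IntegralModel (valuationSubringAtPrime K v) K ((thickening K L).obj X)) [IsProper 𝓨.total.hom]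
    {σ : absoluteGaloisGroup (v.adicCompletion K)} (hσ : IsAbsArithFrob σ)
    (e : L →ₐ[K] AlgebraicClosure (v.adicCompletion K)) (γ : L ≃ₐ[K] L)
    (hγ : ((AlgEquiv.restrictScalars K (absoluteGaloisGroup.toAlgEquiv (v.adicCompletion K) σ) :
        AlgebraicClosure (v.adicCompletion K) ≃ₐ[K] AlgebraicClosure (v.adicCompletion K)) :
        AlgebraicClosure (v.adicCompletion K) →ₐ[K] AlgebraicClosure (v.adicCompletion K)).comp e = e.comp (γ : L →ₐ[K] L))
    (𝔲 : 𝓨.total ⟶ 𝓨.total)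
    (h𝔲 : (genericFibre (valuationSubringAtPrime K v) K).map 𝔲 ≫ 𝓨.genericIso'.hom =
      𝓨.genericIso'.hom ≫ Over.homMk ((thickeningGalAction X).aut γ.symm).hom ((thickeningGalAction X).aut_comp γ.symm))
    (P : AlgPoints X (AlgebraicClosure (v.adicCompletion K))) :
    AlgPoints.map (frobeniusOver 𝓨.reductionAt) (𝓨.geomReductionMap (thickeningLift e X P)) =
      AlgPoints.map ((specialFibreFunctor v).map 𝔲) (𝓨.geomReductionMap (thickeningLift e X (σ • P))) := by
  rw [← 𝓨.geomReductionMap_smul_of_isAbsArithFrob hσ, ← 𝓨.geomReductionMap_map 𝓨 𝔲 _ h𝔲, AlgPoints.adicCompletion_smul_def,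
    AlgPoints.adicCompletion_smul_def, smul_thickeningLift_eq_map_aut_symm _ e γ hγ X P]

/-- **In every `𝔲_s`-invariant Frobenius-compatible reading**: with `(P, mk, Fr)` such that `mk ∘ F̃ = Fr ∘ mk` and `mk ∘ 𝔲_s = mk` (the
binders `_hFr`, `_hinv` of `PointwiseFrobeniusDatumUpstairsAt`), `Fr (mk (red_𝓨 (ℓ_e P))) = mk (red_𝓨 (ℓ_e (σ • P)))`.
[cite: SerreTate1968, §1 Lemma 2] [cite: Shimura1998, §16.3 (1)] [cite: GortzWedhorn2020, (14.20)] -/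
theorem frobenius_reading_geomReductionMap_thickeningLift (X : SchemeOver K)
    (𝓨 : IntegralModel (valuationSubringAtPrime K v) K ((thickening K L).obj X)) [IsProper 𝓨.total.hom]
    {σ : absoluteGaloisGroup (v.adicCompletion K)} (hσ : IsAbsArithFrob σ)
    (e : L →ₐ[K] AlgebraicClosure (v.adicCompletion K)) (γ : L ≃ₐ[K] L)
    (hγ : ((AlgEquiv.restrictScalars K (absoluteGaloisGroup.toAlgEquiv (v.adicCompletion K) σ) :
        AlgebraicClosure (v.adicCompletion K) ≃ₐ[K] AlgebraicClosure (v.adicCompletion K)) :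
        AlgebraicClosure (v.adicCompletion K) →ₐ[K] AlgebraicClosure (v.adicCompletion K)).comp e = e.comp (γ : L →ₐ[K] L))
    (𝔲 : 𝓨.total ⟶ 𝓨.total)
    (h𝔲 : (genericFibre (valuationSubringAtPrime K v) K).map 𝔲 ≫ 𝓨.genericIso'.hom =
      𝓨.genericIso'.hom ≫ Over.homMk ((thickeningGalAction X).aut γ.symm).hom ((thickeningGalAction X).aut_comp γ.symm))
    (Pr : Type*) (mk : AlgPoints 𝓨.reductionAt (geomResidueField v) → Pr) (Fr : Pr → Pr)
    (hFr : ∀ p : AlgPoints 𝓨.reductionAt (geomResidueField v), mk (AlgPoints.map (frobeniusOver 𝓨.reductionAt) p) = Fr (mk p))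
    (hinv : ∀ p : AlgPoints 𝓨.reductionAt (geomResidueField v), mk (AlgPoints.map ((specialFibreFunctor v).map 𝔲) p) = mk p)
    (P : AlgPoints X (AlgebraicClosure (v.adicCompletion K))) :
    Fr (mk (𝓨.geomReductionMap (thickeningLift e X P))) = mk (𝓨.geomReductionMap (thickeningLift e X (σ • P))) := by
  rw [← hFr]
  exact (congrArg mk (𝓨.map_frobeniusOver_geomReductionMap_thickeningLift X hσ e γ hγ 𝔲 h𝔲 P)).trans (hinv _)

/-- **FROB-SHEET over an action, in the binders of the letter UP.**  `X` a `K`-scheme with an action `ρ : G → Aut_K X`, `L ∕ K` ANY normal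
extension, `𝓨` a proper `𝒪_{K,(v)}`-model of `R_L X` carrying an action `θ` of `Aut(L∕K) × G` whose generic fibre is the
product action `τ = thickeningProdAction X ρ` (hypothesis `hθ` = UP's `_hθ`), `(P, mk, Fr)` a Frobenius-compatible reading of the `κ̄(v)`-points
of the special fibre invariant under the `θ(γ, 1)_s` (UP's `_hFr`, `_hinv`), `σ ∈ Γ_{K_v}` an arithmetic Frobenius.  Then for every sheet `e`
and every `P ∈ X(\overline{K_v})`: **`Fr (mk (red_𝓨 (ℓ_e P))) = mk (red_𝓨 (ℓ_e (σ • P)))`**.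
[cite: SerreTate1968, §1 Lemma 2] [cite: Shimura1998, §16.3 (1)] [cite: GortzWedhorn2020, (14.20)] -/
theorem frobenius_reading_thickeningLift_of_actionOver [Normal K L] (X : SchemeOver K) {G : Type*} [Group G] (ρ : G →* Aut X)
    (𝓨 : IntegralModel (valuationSubringAtPrime K v) K ((thickening K L).obj X)) [IsProper 𝓨.total.hom]
    (θ : ActionOver 𝓨.total.hom ((L ≃ₐ[K] L) × G))
    (hθ : ∀ a : (L ≃ₐ[K] L) × G,
      (genericFibre (valuationSubringAtPrime K v) K).map (Over.isoMk (θ.aut a) (θ.aut_comp a)).hom ≫ 𝓨.genericIso'.hom =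
        𝓨.genericIso'.hom ≫ (Over.isoMk ((thickeningProdAction X ρ).aut a) ((thickeningProdAction X ρ).aut_comp a)).hom)
    (Pr : Type*) (mk : AlgPoints 𝓨.reductionAt (geomResidueField v) → Pr) (Fr : Pr → Pr)
    (hFr : ∀ p : AlgPoints 𝓨.reductionAt (geomResidueField v), mk (AlgPoints.map (frobeniusOver 𝓨.reductionAt) p) = Fr (mk p))
    (hinv : ∀ (γ : L ≃ₐ[K] L) (p : AlgPoints 𝓨.reductionAt (geomResidueField v)),
      mk (AlgPoints.map
            ((specialFibreFunctor v).map (Over.isoMk (θ.aut (γ, 1)) (θ.aut_comp (γ, 1))).hom : 𝓨.reductionAt ⟶ 𝓨.reductionAt) p)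
        = mk p)
    {σ : absoluteGaloisGroup (v.adicCompletion K)} (hσ : IsAbsArithFrob σ)
    (e : L →ₐ[K] AlgebraicClosure (v.adicCompletion K)) (P : AlgPoints X (AlgebraicClosure (v.adicCompletion K))) :
    Fr (mk (𝓨.geomReductionMap (thickeningLift e X P))) = mk (𝓨.geomReductionMap (thickeningLift e X (σ • P))) := by
  obtain ⟨γ, hγ⟩ := exists_algEquiv_comp_eq_comp
    (AlgEquiv.restrictScalars K (absoluteGaloisGroup.toAlgEquiv (v.adicCompletion K) σ)) e
  refine 𝓨.frobenius_reading_geomReductionMap_thickeningLift X hσ e γ hγ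
    (Over.isoMk (θ.aut (γ.symm, 1)) (θ.aut_comp (γ.symm, 1))).hom ?_ Pr mk Fr hFr (hinv γ.symm) P
  rw [hθ (γ.symm, 1), isoMk_thickeningProdAction_aut_inl_hom]

/-- Iterated form: `Fr^[n] (mk (red_𝓨 (ℓ_e P))) = mk (red_𝓨 (ℓ_e (σ ^ n • P)))` (for the supersingular clause (c3c), `Fr ∘ Fr`).
[cite: SerreTate1968, §1 Lemma 2] [cite: Shimura1998, §16.3 (1)] -/
theorem iterate_frobenius_reading_thickeningLift_of_actionOver [Normal K L] (X : SchemeOver K) {G : Type*} [Group G]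
    (ρ : G →* Aut X) (𝓨 : IntegralModel (valuationSubringAtPrime K v) K ((thickening K L).obj X)) [IsProper 𝓨.total.hom]
    (θ : ActionOver 𝓨.total.hom ((L ≃ₐ[K] L) × G))
    (hθ : ∀ a : (L ≃ₐ[K] L) × G,
      (genericFibre (valuationSubringAtPrime K v) K).map (Over.isoMk (θ.aut a) (θ.aut_comp a)).hom ≫ 𝓨.genericIso'.hom =
        𝓨.genericIso'.hom ≫ (Over.isoMk ((thickeningProdAction X ρ).aut a) ((thickeningProdAction X ρ).aut_comp a)).hom)
    (Pr : Type*) (mk : AlgPoints 𝓨.reductionAt (geomResidueField v) → Pr) (Fr : Pr → Pr)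
    (hFr : ∀ p : AlgPoints 𝓨.reductionAt (geomResidueField v), mk (AlgPoints.map (frobeniusOver 𝓨.reductionAt) p) = Fr (mk p))
    (hinv : ∀ (γ : L ≃ₐ[K] L) (p : AlgPoints 𝓨.reductionAt (geomResidueField v)),
      mk (AlgPoints.map
            ((specialFibreFunctor v).map (Over.isoMk (θ.aut (γ, 1)) (θ.aut_comp (γ, 1))).hom : 𝓨.reductionAt ⟶ 𝓨.reductionAt) p)
        = mk p)
    {σ : absoluteGaloisGroup (v.adicCompletion K)} (hσ : IsAbsArithFrob σ)
    (e : L →ₐ[K] AlgebraicClosure (v.adicCompletion K)) (n : ℕ) (P : AlgPoints X (AlgebraicClosure (v.adicCompletion K))) :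
    Fr^[n] (mk (𝓨.geomReductionMap (thickeningLift e X P))) = mk (𝓨.geomReductionMap (thickeningLift e X (σ ^ n • P))) := by
  induction n generalizing P with
  | zero => rw [Function.iterate_zero_apply, pow_zero, one_smul]
  | succ n ih =>
      rw [Function.iterate_succ_apply,
        𝓨.frobenius_reading_thickeningLift_of_actionOver X ρ θ hθ Pr mk Fr hFr hinv hσ e P, ih (σ • P), ← mul_smul, ← pow_succ]

variable (K v) in
/-- **The `∃ σ` package** (shape of ★ `exists_isAbsArithFrob_forall_geomReductionMap_smul`): there is `σ ∈ Γ_{K_v}`, an arithmetic Frobenius,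
such that for EVERY normal `L ∕ K`, EVERY `K`-scheme `X` with a `G`-action `ρ`, EVERY proper model `𝓨` of `R_L X` with an action `θ` of
`Aut(L∕K) × G` extending `thickeningProdAction X ρ`, EVERY invariant Frobenius-compatible reading, every sheet `e` and every point `P`:
`Fr (mk (red_𝓨 (ℓ_e P))) = mk (red_𝓨 (ℓ_e (σ • P)))`. [cite: SerreTate1968, §1 Lemma 2] [cite: Shimura1998, §16.3 (1)] -/
theorem exists_isAbsArithFrob_forall_frobenius_reading_thickeningLift :
    ∃ σ : absoluteGaloisGroup (v.adicCompletion K), IsAbsArithFrob σ ∧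
      ∀ (L : Type) [Field L] [Algebra K L] [Normal K L] (X : SchemeOver K) (G : Type) [Group G] (ρ : G →* Aut X)
        (𝓨 : IntegralModel (valuationSubringAtPrime K v) K ((thickening K L).obj X)) [IsProper 𝓨.total.hom]
        (θ : ActionOver 𝓨.total.hom ((L ≃ₐ[K] L) × G)),
        (∀ a : (L ≃ₐ[K] L) × G,
          (genericFibre (valuationSubringAtPrime K v) K).map (Over.isoMk (θ.aut a) (θ.aut_comp a)).hom ≫ 𝓨.genericIso'.hom =
            𝓨.genericIso'.hom ≫ (Over.isoMk ((thickeningProdAction X ρ).aut a) ((thickeningProdAction X ρ).aut_comp a)).hom) →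
        ∀ (Pr : Type) (mk : AlgPoints 𝓨.reductionAt (geomResidueField v) → Pr) (Fr : Pr → Pr),
          (∀ p : AlgPoints 𝓨.reductionAt (geomResidueField v), mk (AlgPoints.map (frobeniusOver 𝓨.reductionAt) p) = Fr (mk p)) →
          (∀ (γ : L ≃ₐ[K] L) (p : AlgPoints 𝓨.reductionAt (geomResidueField v)),
            mk (AlgPoints.map
                  ((specialFibreFunctor v).map (Over.isoMk (θ.aut (γ, 1)) (θ.aut_comp (γ, 1))).hom : 𝓨.reductionAt ⟶ 𝓨.reductionAt) p)
              = mk p) →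
          ∀ (e : L →ₐ[K] AlgebraicClosure (v.adicCompletion K)) (P : AlgPoints X (AlgebraicClosure (v.adicCompletion K))),
            Fr (mk (𝓨.geomReductionMap (thickeningLift e X P))) = mk (𝓨.geomReductionMap (thickeningLift e X (σ • P))) := by
  obtain ⟨σ, hσ⟩ : ∃ σ : absoluteGaloisGroup (v.adicCompletion K), IsAbsArithFrob σ := exists_isAbsArithFrob_holds _
  exact ⟨σ, hσ, fun L _ _ _ X G _ ρ 𝓨 _ θ hθ Pr mk Fr hFr hinv e P =>
    𝓨.frobenius_reading_thickeningLift_of_actionOver X ρ θ hθ Pr mk Fr hFr hinv hσ e P⟩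

end IntegralModel

/-! ## §3 (ED. 2) The letter-MH forms: the Galois part of `θ` read through ★ `thickeningGalAction`, and the UNIFORM Γ-shadow of Frobenius
`Fr₀ := θ(γ_{σ,e}, 1)_s ∘ F̃` with `Fr₀ ∘ red_𝓨 ∘ ℓ_e = red_𝓨 ∘ ℓ_e ∘ (σ • ·)`

EDITION 2 (append-only; B-p18 (g34), for the letter MH `RecordModuliHeartCofinal` of P6a ED. 2 cand 79e999b3 §4.1–§4.2 and its ED.-3 split
`stub_SHEET`).  MH quantifies over actions `θ` of `Γ × G` on the model whose `Γ`-PART has generic fibre the deck action ★ `thickeningGalAction`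
(binder `_hθ`, indexed by `γ : Γ` at `(γ, 1)`, in the `Over.isoMk` shape), and asks for a map `Fr₀` on the plain special points which is a
`Γ`-SHADOW of the geometric Frobenius (`FrobeniusSheet frob act Fr₀ := ∀ p, ∃ γ, Fr₀ p = act γ (frob p)`) towards the reading
`red₀ := red_𝓨 ∘ ℓ_e`.  §2 gives such an `Fr₀` OUTRIGHT and UNIFORMLY: with `γ₀ := γ_{σ,e}` (`σ_K ∘ e = e ∘ γ₀`, ★ `exists_algEquiv_comp_eq_comp`)
put `Fr₀ := θ(γ₀, 1)_s ∘ F̃`; then `Fr₀` is a shadow with the SAME `γ₀` at every point, and on the image of `red₀` it IS `σ`-conjugation downstairs: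
`Fr₀ (red_𝓨 (ℓ_e P)) = θ(γ₀,1)_s (θ(γ₀⁻¹,1)_s (red_𝓨 (ℓ_e (σ • P)))) = red_𝓨 (ℓ_e (σ • P))` (`exists_frobeniusShadow_reading_thickeningLift`,
MH-literal `exists_frobeniusSheet_reading_thickeningLift`, `∃ σ` package `exists_isAbsArithFrob_forall_frobeniusSheet_reading`).  So the HEART's
dictionary towards `(P₀, Fr₀, red₀)` reads its Frobenius clauses (c3a)(c3b)(c3c) as statements about `red₀ (σ • y)`, `y ∈ X(Ω)`. -/

section PlumbingED2

variable {K L : Type u} [Field K] [Field L] [Algebra K L]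

/-- The deck transformation `γ` in the `Over.isoMk` shape of the letters UP ∕ MH is the `Over.homMk` shape of ★ `map_aut_thickeningLift`.
[cite: GortzWedhorn2020, (14.20)] -/
theorem isoMk_thickeningGalAction_aut_hom (X : SchemeOver K) (γ : L ≃ₐ[K] L) :
    (Over.isoMk ((thickeningGalAction (L := L) X).aut γ) ((thickeningGalAction (L := L) X).aut_comp γ)).hom =
      Over.homMk ((thickeningGalAction X).aut γ).hom ((thickeningGalAction X).aut_comp γ) :=
  Over.OverMorphism.ext (Over.isoMk_hom_left _ _)

end PlumbingED2

namespace IntegralModel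

variable {K : Type} [Field K] [NumberField K] {v : HeightOneSpectrum (𝓞 K)} {L : Type} [Field L] [Algebra K L]

/-- **`θ(a)_s ∘ θ(b)_s = id` on the `κ̄(v)`-points of the special fibre when `a * b = 1`** (functoriality of ★ `specialFibreFunctor` and
`θ.aut (a * b) = 1`). [cite: SerreTate1968, §1 Lemma 2] -/
theorem map_specialFibre_aut_map_specialFibre_aut {Y : SchemeOver K} (𝓨 : IntegralModel (valuationSubringAtPrime K v) K Y)
    {H : Type*} [Group H] (θ : ActionOver 𝓨.total.hom H) (a b : H) (hab : a * b = 1) (p : AlgPoints 𝓨.reductionAt (geomResidueField v)) :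
    AlgPoints.map ((specialFibreFunctor v).map (Over.isoMk (θ.aut a) (θ.aut_comp a)).hom : 𝓨.reductionAt ⟶ 𝓨.reductionAt)
        (AlgPoints.map ((specialFibreFunctor v).map (Over.isoMk (θ.aut b) (θ.aut_comp b)).hom : 𝓨.reductionAt ⟶ 𝓨.reductionAt) p) =
      p := by
  have h1 : (Over.isoMk (θ.aut b) (θ.aut_comp b)).hom ≫ (Over.isoMk (θ.aut a) (θ.aut_comp a)).hom = 𝟙 𝓨.total := by
    apply Over.OverMorphism.ext
    change (θ.aut b).hom ≫ (θ.aut a).hom = 𝟙 _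
    rw [← Iso.trans_hom, ← Aut.Aut_mul_def, ← map_mul, hab, map_one]
    rfl
  have h2 : ((specialFibreFunctor v).map (Over.isoMk (θ.aut b) (θ.aut_comp b)).hom : 𝓨.reductionAt ⟶ 𝓨.reductionAt) ≫
      ((specialFibreFunctor v).map (Over.isoMk (θ.aut a) (θ.aut_comp a)).hom : 𝓨.reductionAt ⟶ 𝓨.reductionAt) = 𝟙 𝓨.reductionAt :=
    ((specialFibreFunctor v).map_comp _ _).symm.trans (((specialFibreFunctor v).congr_map h1).trans ((specialFibreFunctor v).map_id _))
  change (p ≫ _) ≫ _ = p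
  exact (Category.assoc _ _ _).trans ((congrArg (fun f => p ≫ f) h2).trans (Category.comp_id p))

/-- **The UNIFORM Γ-shadow of Frobenius and its reading.**  `L ∕ K` normal, `X` a `K`-scheme, `𝓨` a proper `𝒪_{K,(v)}`-model of `R_L X` with an
action `θ` of `Aut(L∕K) × G` whose `Aut(L∕K)`-part has generic fibre the deck action (the binder `_hθ` of the letter MH, literally), `σ ∈ Γ_{K_v}` an
arithmetic Frobenius, `e` a sheet.  Then there are `γ₀ ∈ Aut(L∕K)` and `Fr₀ : 𝓨_s(κ̄) → 𝓨_s(κ̄)` with `Fr₀ = θ(γ₀, 1)_s ∘ F̃` (a Γ-shadow of Frobenius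
with ONE element for all points) and **`Fr₀ (red_𝓨 (ℓ_e P)) = red_𝓨 (ℓ_e (σ • P))`** for every `P ∈ X(\overline{K_v})`.
[cite: SerreTate1968, §1 Lemma 2] [cite: Shimura1998, §16.3 (1)] [cite: GortzWedhorn2020, (14.20)] -/
theorem exists_frobeniusShadow_reading_thickeningLift [Normal K L] (X : SchemeOver K) {G : Type*} [Group G]
    (𝓨 : IntegralModel (valuationSubringAtPrime K v) K ((thickening K L).obj X)) [IsProper 𝓨.total.hom]
    (θ : ActionOver 𝓨.total.hom ((L ≃ₐ[K] L) × G))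
    (hθ : ∀ γ : L ≃ₐ[K] L,
      (genericFibre (valuationSubringAtPrime K v) K).map (Over.isoMk (θ.aut (γ, 1)) (θ.aut_comp (γ, 1))).hom ≫ 𝓨.genericIso'.hom =
        𝓨.genericIso'.hom ≫
          (Over.isoMk ((thickeningGalAction (L := L) X).aut γ) ((thickeningGalAction (L := L) X).aut_comp γ)).hom)
    {σ : absoluteGaloisGroup (v.adicCompletion K)} (hσ : IsAbsArithFrob σ) (e : L →ₐ[K] AlgebraicClosure (v.adicCompletion K)) :
    ∃ (γ₀ : L ≃ₐ[K] L)
      (Fr₀ : AlgPoints 𝓨.reductionAt (geomResidueField v) → AlgPoints 𝓨.reductionAt (geomResidueField v)),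
      (∀ p : AlgPoints 𝓨.reductionAt (geomResidueField v),
        Fr₀ p = AlgPoints.map
            ((specialFibreFunctor v).map (Over.isoMk (θ.aut (γ₀, 1)) (θ.aut_comp (γ₀, 1))).hom : 𝓨.reductionAt ⟶ 𝓨.reductionAt)
          (AlgPoints.map (frobeniusOver 𝓨.reductionAt) p)) ∧
      ∀ P : AlgPoints X (AlgebraicClosure (v.adicCompletion K)),
        Fr₀ (𝓨.geomReductionMap (thickeningLift e X P)) = 𝓨.geomReductionMap (thickeningLift e X (σ • P)) := by
  obtain ⟨γ, hγ⟩ := exists_algEquiv_comp_eq_comp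
    (AlgEquiv.restrictScalars K (absoluteGaloisGroup.toAlgEquiv (v.adicCompletion K) σ)) e
  refine ⟨γ, fun p => AlgPoints.map
      ((specialFibreFunctor v).map (Over.isoMk (θ.aut (γ, 1)) (θ.aut_comp (γ, 1))).hom : 𝓨.reductionAt ⟶ 𝓨.reductionAt)
      (AlgPoints.map (frobeniusOver 𝓨.reductionAt) p), fun _ => rfl, fun P => ?_⟩
  have h𝔲 : (genericFibre (valuationSubringAtPrime K v) K).map (Over.isoMk (θ.aut (γ.symm, 1)) (θ.aut_comp (γ.symm, 1))).hom ≫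
      𝓨.genericIso'.hom =
        𝓨.genericIso'.hom ≫ Over.homMk ((thickeningGalAction X).aut γ.symm).hom ((thickeningGalAction X).aut_comp γ.symm) := by
    rw [hθ γ.symm, isoMk_thickeningGalAction_aut_hom]
  have hab : ((γ, (1 : G)) : (L ≃ₐ[K] L) × G) * (γ.symm, 1) = 1 := Prod.ext (mul_inv_cancel γ) (mul_one 1)
  exact (congrArg (AlgPoints.map ((specialFibreFunctor v).map (Over.isoMk (θ.aut (γ, 1)) (θ.aut_comp (γ, 1))).hom :
      𝓨.reductionAt ⟶ 𝓨.reductionAt)) (𝓨.map_frobeniusOver_geomReductionMap_thickeningLift X hσ e γ hγ _ h𝔲 P)).trans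
    (𝓨.map_specialFibre_aut_map_specialFibre_aut θ (γ, 1) (γ.symm, 1) hab _)

/-- **The letter MH's FROB-SHEET conjunct, literally, with its reading**: there is `Fr₀ : 𝓨_s(κ̄) → 𝓨_s(κ̄)` such that (i)
`∀ p, ∃ γ, Fr₀ p = θ(γ, 1)_s (F̃ p)` — the body of P6a's `FrobeniusSheet (fun p => F̃ p) (fun γ p => θ(γ,1)_s p) Fr₀` — and (ii)
`Fr₀ (red_𝓨 (ℓ_e P)) = red_𝓨 (ℓ_e (σ • P))` for all `P`. [cite: SerreTate1968, §1 Lemma 2] [cite: Shimura1998, §16.3 (1)] [cite: GortzWedhorn2020, (14.20)] -/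
theorem exists_frobeniusSheet_reading_thickeningLift [Normal K L] (X : SchemeOver K) {G : Type*} [Group G]
    (𝓨 : IntegralModel (valuationSubringAtPrime K v) K ((thickening K L).obj X)) [IsProper 𝓨.total.hom]
    (θ : ActionOver 𝓨.total.hom ((L ≃ₐ[K] L) × G))
    (hθ : ∀ γ : L ≃ₐ[K] L,
      (genericFibre (valuationSubringAtPrime K v) K).map (Over.isoMk (θ.aut (γ, 1)) (θ.aut_comp (γ, 1))).hom ≫ 𝓨.genericIso'.hom =
        𝓨.genericIso'.hom ≫
          (Over.isoMk ((thickeningGalAction (L := L) X).aut γ) ((thickeningGalAction (L := L) X).aut_comp γ)).hom)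
    {σ : absoluteGaloisGroup (v.adicCompletion K)} (hσ : IsAbsArithFrob σ) (e : L →ₐ[K] AlgebraicClosure (v.adicCompletion K)) :
    ∃ Fr₀ : AlgPoints 𝓨.reductionAt (geomResidueField v) → AlgPoints 𝓨.reductionAt (geomResidueField v),
      (∀ p : AlgPoints 𝓨.reductionAt (geomResidueField v), ∃ γ : L ≃ₐ[K] L,
        Fr₀ p = AlgPoints.map
            ((specialFibreFunctor v).map (Over.isoMk (θ.aut (γ, 1)) (θ.aut_comp (γ, 1))).hom : 𝓨.reductionAt ⟶ 𝓨.reductionAt)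
          (AlgPoints.map (frobeniusOver 𝓨.reductionAt) p)) ∧
      ∀ P : AlgPoints X (AlgebraicClosure (v.adicCompletion K)),
        Fr₀ (𝓨.geomReductionMap (thickeningLift e X P)) = 𝓨.geomReductionMap (thickeningLift e X (σ • P)) := by
  obtain ⟨γ₀, Fr₀, hFr₀, hred⟩ := 𝓨.exists_frobeniusShadow_reading_thickeningLift X θ hθ hσ e
  exact ⟨Fr₀, fun p => ⟨γ₀, hFr₀ p⟩, hred⟩

/-- **A Γ-shadow of Frobenius is Frobenius in every Γ-invariant Frobenius-compatible reading**: if `Fr₀ p = θ(γ_p, 1)_s (F̃ p)` for all `p`,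
`mk ∘ F̃ = Fr ∘ mk` and `mk ∘ θ(γ, 1)_s = mk` (UP's `_hFr`, `_hinv`), then `mk ∘ Fr₀ = Fr ∘ mk` (the hypothesis of P6a's `frobeniusDichotomy_map`).
[cite: Liu2021, Prop. D.8 (3) p. 135] -/
theorem reading_of_frobeniusSheet {Y : SchemeOver K} (𝓨 : IntegralModel (valuationSubringAtPrime K v) K Y) {Γ' G : Type*} [Group Γ']
    [Group G] (θ : ActionOver 𝓨.total.hom (Γ' × G))
    (Fr₀ : AlgPoints 𝓨.reductionAt (geomResidueField v) → AlgPoints 𝓨.reductionAt (geomResidueField v))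
    (hFr₀ : ∀ p : AlgPoints 𝓨.reductionAt (geomResidueField v), ∃ γ : Γ',
      Fr₀ p = AlgPoints.map
          ((specialFibreFunctor v).map (Over.isoMk (θ.aut (γ, 1)) (θ.aut_comp (γ, 1))).hom : 𝓨.reductionAt ⟶ 𝓨.reductionAt)
        (AlgPoints.map (frobeniusOver 𝓨.reductionAt) p))
    (Pr : Type*) (mk : AlgPoints 𝓨.reductionAt (geomResidueField v) → Pr) (Fr : Pr → Pr)
    (hFr : ∀ p : AlgPoints 𝓨.reductionAt (geomResidueField v), mk (AlgPoints.map (frobeniusOver 𝓨.reductionAt) p) = Fr (mk p))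
    (hinv : ∀ (γ : Γ') (p : AlgPoints 𝓨.reductionAt (geomResidueField v)),
      mk (AlgPoints.map
            ((specialFibreFunctor v).map (Over.isoMk (θ.aut (γ, 1)) (θ.aut_comp (γ, 1))).hom : 𝓨.reductionAt ⟶ 𝓨.reductionAt) p)
        = mk p)
    (p : AlgPoints 𝓨.reductionAt (geomResidueField v)) : mk (Fr₀ p) = Fr (mk p) := by
  obtain ⟨γ, hγ⟩ := hFr₀ p
  exact (congrArg mk hγ).trans ((hinv γ _).trans (hFr p))

variable (K v) in
/-- **The `∃ σ` package of the sheet theorem**: one arithmetic Frobenius `σ ∈ Γ_{K_v}` such that for every normal `L ∕ K`, every `X`, every proper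
model `𝓨` of `R_L X` with an action `θ` as in MH, and every sheet `e`, there is a Γ-shadow `Fr₀` of Frobenius with
`Fr₀ ∘ red_𝓨 ∘ ℓ_e = red_𝓨 ∘ ℓ_e ∘ (σ • ·)`. [cite: SerreTate1968, §1 Lemma 2] [cite: Shimura1998, §16.3 (1)] -/
theorem exists_isAbsArithFrob_forall_frobeniusSheet_reading :
    ∃ σ : absoluteGaloisGroup (v.adicCompletion K), IsAbsArithFrob σ ∧
      ∀ (L : Type) [Field L] [Algebra K L] [Normal K L] (X : SchemeOver K) (G : Type) [Group G]
        (𝓨 : IntegralModel (valuationSubringAtPrime K v) K ((thickening K L).obj X)) [IsProper 𝓨.total.hom]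
        (θ : ActionOver 𝓨.total.hom ((L ≃ₐ[K] L) × G)),
        (∀ γ : L ≃ₐ[K] L,
          (genericFibre (valuationSubringAtPrime K v) K).map (Over.isoMk (θ.aut (γ, 1)) (θ.aut_comp (γ, 1))).hom ≫ 𝓨.genericIso'.hom =
            𝓨.genericIso'.hom ≫
              (Over.isoMk ((thickeningGalAction (L := L) X).aut γ) ((thickeningGalAction (L := L) X).aut_comp γ)).hom) →
        ∀ e : L →ₐ[K] AlgebraicClosure (v.adicCompletion K),
          ∃ Fr₀ : AlgPoints 𝓨.reductionAt (geomResidueField v) → AlgPoints 𝓨.reductionAt (geomResidueField v),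
            (∀ p : AlgPoints 𝓨.reductionAt (geomResidueField v), ∃ γ : L ≃ₐ[K] L,
              Fr₀ p = AlgPoints.map
                  ((specialFibreFunctor v).map (Over.isoMk (θ.aut (γ, 1)) (θ.aut_comp (γ, 1))).hom : 𝓨.reductionAt ⟶ 𝓨.reductionAt)
                (AlgPoints.map (frobeniusOver 𝓨.reductionAt) p)) ∧
            ∀ P : AlgPoints X (AlgebraicClosure (v.adicCompletion K)),
              Fr₀ (𝓨.geomReductionMap (thickeningLift e X P)) = 𝓨.geomReductionMap (thickeningLift e X (σ • P)) := by
  obtain ⟨σ, hσ⟩ : ∃ σ : absoluteGaloisGroup (v.adicCompletion K), IsAbsArithFrob σ := exists_isAbsArithFrob_holds _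
  exact ⟨σ, hσ, fun L _ _ _ X G _ 𝓨 _ θ hθ e => 𝓨.exists_frobeniusSheet_reading_thickeningLift X θ hθ hσ e⟩

end IntegralModel

end Literature.AlgebraicGeometry.Motives

end
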